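import Summits.RiemannHypothesis.RiemannHypothesis.Theses.SpectralTrace
import Summits.RiemannHypothesis.RiemannHypothesis.Theorems.WindowStep.Negative.BothWays
import HarnessLib

/-!
# `WindowStep` — negative lemma: no step below any finite height, even with re-indexing

Refuter (crux disprover) record for the crux `stmt-RiemannHypothesis-14659`
(`Summit.RiemannHypothesis.RiemannHypothesis.Theses.SpectralTrace.WindowStep`). The two-index
form of `FiniteMoves.no_windowStep_below_height`, from `BothWays.lean` and local finiteness
(`finite_abs_le_of_windowTrace`): a "frozen tail + re-worked bottom block" never performs the step,
however the bottom block is re-worked (atoms moved, added, removed, re-indexed).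

* `no_windowStep_of_matched_above_height`: if the atoms of the rung-`A` family `γ` of height
  `> R` are matched injectively into `γ'` (`γ' ∘ e = γ` there) and `γ` is not rung-`B` (`A ≤ B`),
  then `γ'` is not rung-`B` — whatever `γ'` does below height `R` or elsewhere;
* `no_windowStep_of_matched_above_height'`: the same with the matching going from the atoms of
  `γ'` of height `> R` into `γ`.
-/

set_option linter.dupNamespace false

noncomputable section

open Complex Set

namespace Summit.RiemannHypothesis.RiemannHypothesis.Theorems.WindowStep.Negative

open Literature.NumberTheory.LFunctions
open Summit.RiemannHypothesis.RiemannHypothesis.Theses.SpectralTrace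
open Summit.RiemannHypothesis.RiemannHypothesis.Theorems.WindowTraceArch.Negative

/-- **No step below any finite height (old tail frozen).** Let `γ` reproduce `W` on the tests
supported in `[-A, A]` but not on those supported in `[-B, B]` (`0 < A ≤ B`), and let the atoms
of `γ` of height `|γ_i| > R` be matched injectively into a family `γ'` (`γ' (e i) = γ i`). Then
`γ'` does not reproduce `W` on `[-B, B]`: the unmatched old atoms would have to be infinitely
many (`infinite_unmatched_of_windowStep`), but they all have height `≤ R` (finitely many by
`finite_abs_le_of_windowTrace`). [folklore] -/
theorem no_windowStep_of_matched_above_height {A B : ℝ} (hA : 0 < A) (hAB : A ≤ B)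
    {ι ι' : Type*} {γ : ι → ℝ} {γ' : ι' → ℝ} (R : ℝ)
    {e : {i // R < |γ i|} → ι'} (he : Function.Injective e) (hext : ∀ x, γ' (e x) = γ x)
    (hAγ : ∀ g : ℝ → ℂ, IsWeilTest g → tsupport g ⊆ Icc (-A) A →
      HasSum (fun i => weilMellin g (1 / 2 + (γ i : ℂ) * I)) (weilFunctional g))
    (hBγ : ¬ ∀ g : ℝ → ℂ, IsWeilTest g → tsupport g ⊆ Icc (-B) B →
      HasSum (fun i => weilMellin g (1 / 2 + (γ i : ℂ) * I)) (weilFunctional g)) :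
    ¬ ∀ g : ℝ → ℂ, IsWeilTest g → tsupport g ⊆ Icc (-B) B →
      HasSum (fun j => weilMellin g (1 / 2 + (γ' j : ℂ) * I)) (weilFunctional g) := by
  intro hBγ'
  have hinf := infinite_unmatched_of_windowStep hA hAB {i : ι | R < |γ i|}
    (e := fun x => e ⟨x.1, x.2⟩) (fun x y hxy => Subtype.ext (congrArg Subtype.val (he hxy)))
    (fun x => hext ⟨x.1, x.2⟩) hAγ hBγ hBγ'
  refine hinf ((finite_abs_le_of_windowTrace hA hAγ R).subset fun i hi => ?_)
  simp only [mem_compl_iff, mem_setOf_eq, not_lt] at hi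
  exact hi

/-- **No step below any finite height (new tail frozen).** The same with the matching going the
other way: the atoms of `γ'` of height `|γ'_j| > R` are matched injectively into `γ`
(`γ (e' j) = γ' j`). [folklore] -/
theorem no_windowStep_of_matched_above_height' {A B : ℝ} (hA : 0 < A) (hAB : A ≤ B)
    {ι ι' : Type*} {γ : ι → ℝ} {γ' : ι' → ℝ} (R : ℝ)
    {e' : {j // R < |γ' j|} → ι} (he' : Function.Injective e') (hext' : ∀ x, γ (e' x) = γ' x)
    (hAγ : ∀ g : ℝ → ℂ, IsWeilTest g → tsupport g ⊆ Icc (-A) A →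
      HasSum (fun i => weilMellin g (1 / 2 + (γ i : ℂ) * I)) (weilFunctional g))
    (hBγ : ¬ ∀ g : ℝ → ℂ, IsWeilTest g → tsupport g ⊆ Icc (-B) B →
      HasSum (fun i => weilMellin g (1 / 2 + (γ i : ℂ) * I)) (weilFunctional g)) :
    ¬ ∀ g : ℝ → ℂ, IsWeilTest g → tsupport g ⊆ Icc (-B) B →
      HasSum (fun j => weilMellin g (1 / 2 + (γ' j : ℂ) * I)) (weilFunctional g) := by
  intro hBγ'
  have hAγ' : ∀ g : ℝ → ℂ, IsWeilTest g → tsupport g ⊆ Icc (-A) A →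
      HasSum (fun j => weilMellin g (1 / 2 + (γ' j : ℂ) * I)) (weilFunctional g) :=
    fun g hg hgs => hBγ' g hg (hgs.trans (Icc_subset_Icc (neg_le_neg hAB) hAB))
  have hinf := infinite_unadded_of_windowStep hA hAB {j : ι' | R < |γ' j|}
    (e' := fun x => e' ⟨x.1, x.2⟩) (fun x y hxy => Subtype.ext (congrArg Subtype.val (he' hxy)))
    (fun x => hext' ⟨x.1, x.2⟩) hAγ hBγ hBγ'
  refine hinf ((finite_abs_le_of_windowTrace hA hAγ' R).subset fun j hj => ?_)
  simp only [mem_compl_iff, mem_setOf_eq, not_lt] at hj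
  exact hj

end Summit.RiemannHypothesis.RiemannHypothesis.Theorems.WindowStep.Negative

end
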